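import Literature.MathematicalPhysics.QuantumFieldTheory.Balaban1983to89.B8Thm4TruncationLocal

/-!
# `Balaban1983to89.B8Thm4InductionLocal` — T. Bałaban, *Spaces of regular gauge field configurations on a lattice and gauge fixing
# conditions*, Commun. Math. Phys. **99** (1985) 75–102 [Balaban1985RegularSpaces] ("B8"), THEOREM 4 p. 88, EXISTENCE CLAUSE: THE INDUCTION
# ON THE NUMBER OF LEVELS («A proof of the first step, for k = 1, will be included in a proof of the general step. Thus let us assume that
# Theorem 4 holds for some k − 1 and we will prove it for k», p. 88) RUN ON THE CONCRETE `ℤᵈ` CARRIERS, modulo the two printed ingredients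
# used between consecutive levels — Proposition 5 (existence, (1.107)–(1.108)) and Proposition 3 (the first member of (1.36)) — as sockets

statement-level skeleton of published theorems with citation tags; proofs where landed; nothing here is a claim about the
Yang–Mills mass gap

PDF held: `paper:balaban1985-cmp99-regular-spaces-gauge-fixing` (journal page = PDF page + 74); pp. 88–89, 94–95 [PDF 14–15, 20–21] read on the
text layer by this seat (2026-08-26).

WHAT IS PRINTED.  p. 88: "Of course this theorem implies Theorem 2. Proposition 3 implies that it is enough to prove (1.37), (1.38) and
`U₁ = e^{iηA}`, `|A| < B′₁(α₀ + α₁)(Lʲη)⁻¹` on `Ω_j`, `B′₁ = C′₁B₁` (1.67) with an absolute constant `C′₁` … A proof of the first step, for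
`k = 1`, will be included in a proof of the general step. Thus let us assume that Theorem 4 holds for some `k − 1` and we will prove it for
`k`. … Applying the inductive hypothesis we get a gauge transformation `u₁` such that (1.68) … (1.69)"; p. 89: "They are satisfied in the
case `k = 1` also, if we take `u₁ = 1`, `U′ = U₁`"; pp. 94–95: "It gives us a gauge transformation `u = u′u₁` such that the conditions (1.29),
(1.37), (1.38) are satisfied … (1.110) hence … (1.111) … Thus all the assumptions of Proposition 3 are satisfied and for `α₀ + α₁`
sufficiently small it implies Theorem 4, except the uniqueness statement."

WHY THIS FILE (the N05 KNIT seat: the existence half of `B8.Thm4SkeletonR.thm4R_all` — `base`, `ind_of`, `t4e_of` composed over all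
levels — on the concrete carriers).  The step at one level is this seat's `B8Thm4ExistsLocal.thm4_exists_step_onBonds` (from the inductive
datum and Proposition 5's existence clause, with (1.110)–(1.111) a tree theorem of `pub-ymgap-dag-n04-b`); the base datum is
`B8Thm4TruncationLocal.base_datum` / `restr129_one`.  What print uses BETWEEN two levels is exactly two published propositions, entered here
as SOCKETS (hypothesis shapes quantified over the data the induction produces, nothing re-proved): Proposition 5, existence part, at level
`m + 1` for the datum `(u₁, U₁ = U′^{u₁⁻¹}, A)` delivered by level `m` (`hP5`; for the first step the datum «`u₁ = 1`, `U′ = U₁`», `hP5base`), and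
Proposition 3 at level `m`, first member of (1.36), which RESETS the constant of (1.62) (`B′₁ = C′₁B₁`) to `B₁` before the next step (`hP3`) —
without it the constant would iterate `c ↦ 2Lc + 8α₄` and grow geometrically in the number of levels; with it the induction closes with
LEVEL-INDEPENDENT constants, as print's «absolute constant C′₁».  The Landau equation is an abstract level-indexed predicate `Lan m` (its
operator `R(U₀)` for the `m`-level constraint structure is not yet an object of the tree on these carriers, I-B8-2); the constraint sets of the
level-`m` datum are an arbitrary `Λs m` (their truncation relation `Λs m` ↔ `Λs (m+1)`, «`Λ_{k−1} ∪ B(Λ_k)` as `Λ_{k−1}`», matters only to the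
provider of `hP5`, cf. `B8Thm4TruncationLocal.restr129_truncate_iff_cond168`); the bonds «of `Ω_j`» are an arbitrary antitone family `E j`.

WHAT THIS FILE PROVES (kernel, 0 sorry, theorems only, no `def`; conventions of the siblings).
* **`thm4_exists_all_levels`** — for every `m ≤ k`: there is a unitary-valued gauge transformation `u` with (1.29) at `m` levels
  (`Restr129 L m (Λs m) U₀ u`) such that `W = U′^{u⁻¹}` (`mgauge U₀ u W = U′`) satisfies (1.38) (`Lan m W`) and, on every bond `b ∈ E j`, `j ≤ m`:
  `W_b = e^{iηA_b}`, `A_b` self-adjoint, `‖A_b‖ ≤ c⋆(Lʲη)⁻¹` (the (1.36)/(1.69) first member with the reset constant `c⋆ = B₁(α₀ + α₁)`) — by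
  induction on `m` from the base datum (`m = 0`: `u = 1`, `W = U′`, `A = (1/iη) log U′`, smallness `‖U′_b − 1‖ ≤ a` on `E 0` = (1.66) at level
  `0`), each step being `thm4_exists_step_onBonds` fed by `hP5` (resp. `hP5base`) and followed by `hP3`.

READINGS / DECLARED DEVIATIONS.  (i) Levels are counted by the number `m` of averaging levels of the datum (`m = 0` = the base, print's
«k = 1» step = `m = 0 ↦ 1`).  (ii) Sockets: `hP5base` / `hP5 m` = Proposition 5 (existence) for the data the induction actually produces
(hypotheses: `u₁` unitary-valued with (1.29) at `m` levels — for the truncated constraint sets this is (1.68) —, `U₁ = U′^{u₁⁻¹}` in the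
Landau gauge of level `m`, `U₁ = e^{iηA}` with `A` self-adjoint and `‖A_b‖ ≤ c⋆(Lʲη)⁻¹` on `E j`, `j ≤ m`; conclusion: the data `(v, λ)` of
`thm4_exists_step_onBonds` at level `m + 1`); the gradient member of (1.69) and `u₁`'s (1.73)–(1.74), which Proposition 5 also consumes,
are for its provider to derive from these (Proposition 3's second member; `B8Eq106Local`), as print does; `hP3 m` = Proposition 3 at
level `m`, first member, for gauge-fixed fields `W = U′^{u⁻¹}` with (1.29), (1.38), (1.41)=(1.62) (hypothesis (1.37)/(1.40) are for its
provider: the carrier law `B8Eq137QjEqB` and gauge invariance).  (iii) Smallness explicit and merely sufficient (`α₄ ≤ 1/84`, `Lc⋆ ≤ 1/12`,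
`a ≤ 1/4`, `2a ≤ c⋆`).  (iv) Bond sets `E j` antitone (`Ω_{j+1} ⊂ Ω_j`), so a level-`j` bound is read on `E (j+1)` one level up
(`B8Eq1110Concrete.ineq1111_of_1110`'s factor `L`).  NOT CLAIMED: Propositions 3 and 5, the uniqueness clause (sibling `B8Thm4UniqueLocal`),
(1.37) (carrier law); nothing of the node N05 is discharged by this file.  Unit `pub-ymgap-dag-n05-a` (g3), 2026-08-26.  Tree API by name
only, nothing restated.
-/

noncomputable section

open NormedSpace

namespace Literature.MathematicalPhysics.QuantumFieldTheory.Balaban1983to89.B8Thm4InductionLocal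

open Complex (I)
open MatrixLog B7Prop1Explicit B7Prop2Explicit B7Prop1Local B7Eq92Concrete
open B8Ineq132 (covDerivFwd)
open B8Eq119TwistedAxial (Restr129)
open B8Eq184Proof (gaugeExp cfgExp)
open B8Thm4ExistsLocal (thm4_exists_step_onBonds)
open B8Thm4TruncationLocal (base_datum restr129_one)

-- `Site` alone could resolve to the torus sites of `Setup.lean`; re-export the `ℤ^d` sites of `B7Prop1Explicit`.
export B7Prop1Explicit (Site)

variable {d : ℕ}

section Main

variable {𝔸 : Type*} [CStarAlgebra 𝔸] [Nontrivial 𝔸]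
variable {L k : ℕ} {η : ℝ} {U₀ U' : Site d → Fin d → 𝔸ˣ} {a cstar α₄ : ℝ}

/-- One level up costs a factor `L`: `c⋆(Lʲη)⁻¹ = (Lc⋆)(L^{j+1}η)⁻¹` and `c⋆(Lʲη)⁻¹ ≤ (Lc⋆)(Lʲη)⁻¹` (`L ≥ 1`, `c⋆ ≥ 0`) — the bookkeeping of
(1.111) (`B8Eq1110Concrete.ineq1111_of_1110`). [cite: Balaban1985RegularSpaces, (1.111) p.95] -/
private theorem level_shift (hL1 : 1 ≤ L) (hη : 0 < η) (hc : 0 ≤ cstar) (j : ℕ) :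
    cstar * ((L : ℝ) ^ j * η)⁻¹ = L * cstar * ((L : ℝ) ^ (j + 1) * η)⁻¹ ∧
      cstar * ((L : ℝ) ^ j * η)⁻¹ ≤ L * cstar * ((L : ℝ) ^ j * η)⁻¹ := by
  have hLr : (1 : ℝ) ≤ L := by exact_mod_cast hL1
  have hL0 : (0 : ℝ) < L := by linarith
  have ht : 0 ≤ ((L : ℝ) ^ j * η)⁻¹ := by positivity
  refine ⟨?_, ?_⟩
  · rw [pow_succ]
    field_simp
  · calc cstar * ((L : ℝ) ^ j * η)⁻¹ = 1 * cstar * ((L : ℝ) ^ j * η)⁻¹ := by ring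
      _ ≤ L * cstar * ((L : ℝ) ^ j * η)⁻¹ := by gcongr

/-- **THEOREM 4, EXISTENCE CLAUSE, BY INDUCTION ON THE NUMBER OF LEVELS, ON THE CONCRETE `ℤᵈ` CARRIERS — MODULO PROPOSITION 5 (existence)
AND PROPOSITION 3 (first member of (1.36)) AS SOCKETS.**  Data: `U₀`, `U′` unitary-valued; an antitone family of bond sets `E j` («bonds of
Ω_j»); the base smallness `‖U′_b − 1‖ ≤ a` on `E 0` ((1.66) at level `0`), `a ≤ 1/4`, `2a ≤ c⋆`; constants `α₄ ≤ 1/84` ((1.108):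
`8B′₀B₁(α₀ + α₁)`), `Lc⋆ ≤ 1/12` (`c⋆ = B₁(α₀ + α₁)`); the level-indexed Landau predicate `Lan` and constraint sets `Λs`.  Sockets: `hP5base`
(Proposition 5 at level `1` for the base datum «`u₁ = 1`, `U′ = U₁`» — stated outright for `(1, U′)`, its (1.69) being the provider's from
(1.66)₀ / Lemma 1, «at least for B₁ not too small»), `hP5` (Proposition 5 at level `m + 1`, `1 ≤ m < k`, for the level-`m` datum), `hP3`
(Proposition 3 at level `m`, `1 ≤ m ≤ k`: the reset `B′₁ ↦ B₁` of the bound on `A`).  CONCLUSION: for every `m ≤ k` a unitary-valued `u` with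
(1.29) at `m` levels whose `W = U′^{u⁻¹}` satisfies `Lan m W` (for `m ≥ 1`) and `W_b = e^{iηA_b}`, `A_b` self-adjoint, `‖A_b‖ ≤ c⋆(Lʲη)⁻¹` on
`E j`, `j ≤ m`. [cite: Balaban1985RegularSpaces, Thm 4 p.88, proof pp.88–89 + 94–95, Prop. 5 (1.107)–(1.108) p.94, Prop. 3 p.87] -/
theorem thm4_exists_all_levels (hL1 : 1 ≤ L) (hη : 0 < η)
    (hU₀ : ∀ x κ, U₀ x κ ∈ unitaryUnits 𝔸) (hU' : ∀ x κ, U' x κ ∈ unitaryUnits 𝔸)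
    (hcstar : 0 ≤ cstar) (hα₄ : 0 ≤ α₄) (hs₁ : α₄ ≤ 1 / 84) (hs₂ : L * cstar ≤ 1 / 12) (ha : a ≤ 1 / 4) (ha2 : 2 * a ≤ cstar)
    (E : ℕ → Set (Site d × Fin d)) (hE : ∀ j, E (j + 1) ⊆ E j)
    (h66 : ∀ b ∈ E 0, ‖((U' b.1 b.2 : 𝔸ˣ) : 𝔸) - 1‖ ≤ a)
    (Λs : ℕ → ℕ → Set (Site d)) (Lan : ℕ → (Site d → Fin d → 𝔸ˣ) → Prop)
    (hP5base : ∃ (v : Site d → 𝔸ˣ) (lam : Site d → 𝔸), (∀ x, v x ∈ unitaryUnits 𝔸) ∧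
        (∀ j, j ≤ 1 → ∀ b ∈ E j, (v b.1 : 𝔸) = ((gaugeExp lam b.1 : 𝔸ˣ) : 𝔸) ∧
          (v (b.1 + e b.2) : 𝔸) = ((gaugeExp lam (b.1 + e b.2) : 𝔸ˣ) : 𝔸)) ∧
        (∀ j, j ≤ 1 → ∀ b ∈ E j, ‖lam b.1‖ ≤ α₄ ∧ ((L : ℝ) ^ j * η) * ‖covDerivFwd η U₀ b.2 lam b.1‖ ≤ α₄) ∧
        Lan 1 (mgauge U₀ v⁻¹ U') ∧ Restr129 L 1 (Λs 1) U₀ ((1 : Site d → 𝔸ˣ) * v))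
    (hP5 : ∀ m, 1 ≤ m → m < k → ∀ (u₁ : Site d → 𝔸ˣ) (U₁ : Site d → Fin d → 𝔸ˣ) (A : Site d → Fin d → 𝔸),
      (∀ x, u₁ x ∈ unitaryUnits 𝔸) → mgauge U₀ u₁ U₁ = U' → Restr129 L m (Λs m) U₀ u₁ → Lan m U₁ →
      (∀ j, j ≤ m → ∀ b ∈ E j, U₁ b.1 b.2 = cfgExp η A b.1 b.2 ∧ IsSelfAdjoint (A b.1 b.2) ∧ ‖A b.1 b.2‖ ≤ cstar * ((L : ℝ) ^ j * η)⁻¹) →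
      ∃ (v : Site d → 𝔸ˣ) (lam : Site d → 𝔸), (∀ x, v x ∈ unitaryUnits 𝔸) ∧
        (∀ j, j ≤ m + 1 → ∀ b ∈ E j, (v b.1 : 𝔸) = ((gaugeExp lam b.1 : 𝔸ˣ) : 𝔸) ∧
          (v (b.1 + e b.2) : 𝔸) = ((gaugeExp lam (b.1 + e b.2) : 𝔸ˣ) : 𝔸)) ∧
        (∀ j, j ≤ m + 1 → ∀ b ∈ E j, ‖lam b.1‖ ≤ α₄ ∧ ((L : ℝ) ^ j * η) * ‖covDerivFwd η U₀ b.2 lam b.1‖ ≤ α₄) ∧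
        Lan (m + 1) (mgauge U₀ v⁻¹ U₁) ∧ Restr129 L (m + 1) (Λs (m + 1)) U₀ (u₁ * v))
    (hP3 : ∀ m, 1 ≤ m → m ≤ k → ∀ (u : Site d → 𝔸ˣ) (W : Site d → Fin d → 𝔸ˣ) (A : Site d → Fin d → 𝔸),
      (∀ x, u x ∈ unitaryUnits 𝔸) → mgauge U₀ u W = U' → Restr129 L m (Λs m) U₀ u → Lan m W →
      (∀ j, j ≤ m → ∀ b ∈ E j, W b.1 b.2 = cfgExp η A b.1 b.2 ∧ ‖A b.1 b.2‖ ≤ (2 * (L * cstar) + 8 * α₄) * ((L : ℝ) ^ j * η)⁻¹) →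
      ∀ j, j ≤ m → ∀ b ∈ E j, ‖A b.1 b.2‖ ≤ cstar * ((L : ℝ) ^ j * η)⁻¹) :
    ∀ m, m ≤ k → ∃ u : Site d → 𝔸ˣ, (∀ x, u x ∈ unitaryUnits 𝔸) ∧ Restr129 L m (Λs m) U₀ u ∧
      ∃ W : Site d → Fin d → 𝔸ˣ, mgauge U₀ u W = U' ∧ (1 ≤ m → Lan m W) ∧
        ∃ A : Site d → Fin d → 𝔸, ∀ j, j ≤ m → ∀ b ∈ E j,
          W b.1 b.2 = cfgExp η A b.1 b.2 ∧ IsSelfAdjoint (A b.1 b.2) ∧ ‖A b.1 b.2‖ ≤ cstar * ((L : ℝ) ^ j * η)⁻¹ := by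
  have hLc : 0 ≤ L * cstar := by positivity
  -- reading a `c⋆`-bound at levels `≤ m` as an `Lc⋆`-bound at levels `≤ m + 1` (`E` antitone)
  have hshift : ∀ (m : ℕ) (A : Site d → Fin d → 𝔸),
      (∀ j, j ≤ m → ∀ b ∈ E j, ‖A b.1 b.2‖ ≤ cstar * ((L : ℝ) ^ j * η)⁻¹) →
      ∀ j, j ≤ m + 1 → ∀ b ∈ E j, ‖A b.1 b.2‖ ≤ L * cstar * ((L : ℝ) ^ j * η)⁻¹ := by
    intro m A h j hj b hb
    rcases Nat.lt_or_ge j (m + 1) with hjm | hjm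
    · exact (h j (by omega) b hb).trans (level_shift hL1 hη hcstar j).2
    · obtain rfl : j = m + 1 := le_antisymm hj hjm
      have h' := h m le_rfl b (hE m hb)
      rw [(level_shift hL1 hη hcstar m).1] at h'
      exact h'
  -- THE COMMON TAIL OF A STEP: level-`m` datum + Proposition 5's data at level `m + 1` ⇒ the conclusion at level `m + 1`
  -- (`thm4_exists_step_onBonds` with `c := Lc⋆`, then the reset `hP3 (m + 1)`)
  have tail : ∀ m, m < k → ∀ (u₁ : Site d → 𝔸ˣ) (U₁ : Site d → Fin d → 𝔸ˣ) (A : Site d → Fin d → 𝔸),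
      (∀ x, u₁ x ∈ unitaryUnits 𝔸) → mgauge U₀ u₁ U₁ = U' →
      (∀ j, j ≤ m → ∀ b ∈ E j, U₁ b.1 b.2 = cfgExp η A b.1 b.2 ∧ IsSelfAdjoint (A b.1 b.2) ∧
        ‖A b.1 b.2‖ ≤ cstar * ((L : ℝ) ^ j * η)⁻¹) →
      ∀ (v : Site d → 𝔸ˣ) (lam : Site d → 𝔸), (∀ x, v x ∈ unitaryUnits 𝔸) →
        (∀ j, j ≤ m + 1 → ∀ b ∈ E j, (v b.1 : 𝔸) = ((gaugeExp lam b.1 : 𝔸ˣ) : 𝔸) ∧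
          (v (b.1 + e b.2) : 𝔸) = ((gaugeExp lam (b.1 + e b.2) : 𝔸ˣ) : 𝔸)) →
        (∀ j, j ≤ m + 1 → ∀ b ∈ E j, ‖lam b.1‖ ≤ α₄ ∧ ((L : ℝ) ^ j * η) * ‖covDerivFwd η U₀ b.2 lam b.1‖ ≤ α₄) →
        Lan (m + 1) (mgauge U₀ v⁻¹ U₁) → Restr129 L (m + 1) (Λs (m + 1)) U₀ (u₁ * v) →
      ∃ u : Site d → 𝔸ˣ, (∀ x, u x ∈ unitaryUnits 𝔸) ∧ Restr129 L (m + 1) (Λs (m + 1)) U₀ u ∧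
        ∃ W : Site d → Fin d → 𝔸ˣ, mgauge U₀ u W = U' ∧ (1 ≤ m + 1 → Lan (m + 1) W) ∧
          ∃ A' : Site d → Fin d → 𝔸, ∀ j, j ≤ m + 1 → ∀ b ∈ E j,
            W b.1 b.2 = cfgExp η A' b.1 b.2 ∧ IsSelfAdjoint (A' b.1 b.2) ∧ ‖A' b.1 b.2‖ ≤ cstar * ((L : ℝ) ^ j * η)⁻¹ := by
    intro m hmk u₁ U₁ A hu₁ hU₁ hA v lam hv hvlam h108 hLan h129
    -- `U₁ = e^{iηA}` and (1.69) with `c = Lc⋆` on `E j`, `j ≤ m + 1`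
    have hAexp : ∀ j, j ≤ m + 1 → ∀ b ∈ E j, U₁ b.1 b.2 = cfgExp η A b.1 b.2 := by
      intro j hj b hb
      rcases Nat.lt_or_ge j (m + 1) with hjm | hjm
      · exact (hA j (by omega) b hb).1
      · obtain rfl : j = m + 1 := le_antisymm hj hjm
        exact (hA m le_rfl b (hE m hb)).1
    have h69 := hshift m A (fun j hj b hb => (hA j hj b hb).2.2)
    obtain ⟨u, hu, h29, W, hW, hLanW, A', hA'⟩ := thm4_exists_step_onBonds (k := m + 1) (Λ := Λs (m + 1)) hL1 hη hU₀ hU'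
      hu₁ hv hLc hα₄ hs₁ hs₂ hU₁ E hAexp h69 hvlam h108 (Lan (m + 1)) hLan h129
    -- Proposition 3 at level `m + 1`: reset the constant `2Lc⋆ + 8α₄ ↦ c⋆`
    have hreset := hP3 (m + 1) (by omega) (by omega) u W A' hu hW h29 hLanW
      (fun j hj b hb => ⟨(hA' j hj b hb).1, (hA' j hj b hb).2.2⟩)
    exact ⟨u, hu, h29, W, hW, fun _ => hLanW, A', fun j hj b hb => ⟨(hA' j hj b hb).1, (hA' j hj b hb).2.1, hreset j hj b hb⟩⟩
  -- THE BASE DATUM: `u = 1`, `W = U′`, `A₀ = (1/iη) log U′`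
  have base : ∀ j, j ≤ 0 → ∀ b ∈ E j,
      U' b.1 b.2 = cfgExp η (fun y μ => η⁻¹ • ((I⁻¹ : ℂ) • mlog ((U' y μ : 𝔸ˣ) : 𝔸))) b.1 b.2 ∧
        IsSelfAdjoint ((fun y μ => η⁻¹ • ((I⁻¹ : ℂ) • mlog ((U' y μ : 𝔸ˣ) : 𝔸))) b.1 b.2) ∧
        ‖(fun y μ => η⁻¹ • ((I⁻¹ : ℂ) • mlog ((U' y μ : 𝔸ˣ) : 𝔸))) b.1 b.2‖ ≤ cstar * ((L : ℝ) ^ j * η)⁻¹ := by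
    intro j hj b hb
    obtain rfl : j = 0 := Nat.le_zero.mp hj
    obtain ⟨-, hexp, hsa, hbd⟩ := base_datum hη U₀ U' hU' ha b.1 b.2 (h66 b hb)
    refine ⟨hexp, hsa, hbd.trans ?_⟩
    rw [pow_zero, one_mul]
    exact mul_le_mul_of_nonneg_right ha2 (inv_nonneg.mpr hη.le)
  have hone : mgauge U₀ (1 : Site d → 𝔸ˣ) U' = U' := by
    funext z μ; simp [mgauge_apply]
  intro m
  induction m with
  | zero =>
    intro _
    exact ⟨1, fun x => (unitaryUnits 𝔸).one_mem, restr129_one L 0 (Λs 0) U₀, U', hone, fun h => absurd h (by omega), _, base⟩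
  | succ m ih =>
    intro hmk
    rcases Nat.eq_zero_or_pos m with rfl | hm
    · -- the first step («k = 1»): Proposition 5 for the base datum
      obtain ⟨v, lam, hv, hvlam, h108, hLan, h129⟩ := hP5base
      exact tail 0 (by omega) 1 U' _ (fun x => (unitaryUnits 𝔸).one_mem) hone base v lam hv hvlam h108 hLan h129
    · -- the general step: Proposition 5 for the datum delivered at level `m`
      obtain ⟨u₁, hu₁, h129₁, U₁, hU₁, hLan₁, A, hA⟩ := ih (by omega)
      obtain ⟨v, lam, hv, hvlam, h108, hLan, h129⟩ := hP5 m hm (by omega) u₁ U₁ A hu₁ hU₁ h129₁ (hLan₁ hm) hA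
      exact tail m (by omega) u₁ U₁ A hu₁ hU₁ hA v lam hv hvlam h108 hLan h129

end Main

end Literature.MathematicalPhysics.QuantumFieldTheory.Balaban1983to89.B8Thm4InductionLocal

end
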